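/- Copyright: the b2b-balaban cell (near-miss cell 7), T⁴-continuum fan-out, lineage t4-ne7b-p1 (node U5c COUNT
member).  Released under the licence of the surrounding project. -/
import Summits.QuantumFields.BalabanUV.T4Continuum.Support.HistoryGenealogyExtractionLedger
import Summits.QuantumFields.BalabanUV.T4Continuum.Support.HistorySiblingEntropySortPhys

/-!
# Genealogy extraction, part 4 (H3-(ID), combinatorial half): ANCESTORS, the ORDER-FREE birth key `pbirths` of the
extracted genealogies in closed form, its duplicate-freeness and its DISJOINTNESS across distinct live components —
the injective slotting the COUNT road needs (owner module of row NE7b, lineage `t4-ne7b-p1` gen 39, ruling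
R-OWNER-39-1; re-open object (α), `SCOPE-alpha.md` v2 §5 row M3a — PRE-POSITIONING ONLY)

Summits-side support leaf of the T⁴-continuum cell (rung (B)+1 on a FINITE torus only; NOT infinite volume, NOT the
mass gap, NOT the Clay statement; NOT a proof of the spine estimate NE7b, which is the cell's OWN estimate, NOT PRINTED
and NOT PROVED).  [folklore] finite combinatorics over parts 1–2 and the census carrier `PGen.pbirths` of
`HistorySiblingEntropySortPhys` (ruling R-OWNER-23-3: the order-free occupant key of S12e); nothing printed is
asserted, no `def … : Prop` fact of Bałaban's, no cite-tagged hypothesis, zero `sorry`.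

WHAT IS DEFINED AND PROVED (under `WF` where stated).
§1 `anc H j c i : Finset γ` — the ANCESTORS at level `i` of component `c` of level `j` (itself at `i = j`; the parts'
ancestors below; nothing above); `anc_subset_comp` (ancestors are components of their level); **`anc_disjoint`**:
distinct components of one level have DISJOINT ancestor sets at every level (from `WF.parts_disj`, by induction) —
the maximal structures partition the (level, component) pairs they contain.
§2 `pbirths` along the extraction: `pbirths_joinTail`, `pbirths_assemble`, the one-step equation **`pbirths_pgen_succ`**
(the key of the genealogy of `c ∈ comp (j+1)` = the sum of its parts' keys + one entry `((j+1, 0, cls n), n)` per new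
region inside) and `pbirths_pgen_zero`; the STEP BOUND `step_le_of_mem_pbirths_pgen` (every booked birth of `pgen j c`
happened at a step `≤ j`).
§3 **`mem_pbirths_pgen_iff`** — THE CLOSED FORM: `(e, n) ∈ pbirths (pgen j c)` iff `e = (i, 0, cls n)` for a level
`i ≤ j` and an ancestor `a ∈ anc j c i` with `n ∈ news i a`; hence **`pbirths_pgen_disjoint`**: distinct components of
one level have DISJOINT birth keys (ancestors disjoint + `WF.news_disj`), and **`pbirths_pgen_nodup`**: the key is
duplicate-free (`WF.news_nodup` + the same disjointness); `root_mem_pbirths` (any `PGen`: the root is a booked birth)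
and **`root_injective`**: distinct components of one level have distinct (root step, root cell) — the order-free key
and already the root datum computed from print's bookkeeping SEPARATE the live structures, which is the injectivity an
entropy count over slots (`BSlot`: root step, root cell, shape) needs.  §4 decided sanity on part 2's toy.

HONEST.  Proves nothing of Bałaban's; BY-NAME EFFECT ON THE WALL: NONE (pre-positioning for (α)); NE7b NOT proved; spine
0∕9.  HONEST DEPENDENCY (cell): continuum YM on T⁴ ⇐ BetaPertH ∧ nine spine estimates (0/9 proved); BetaPertH ⇐ (D1) ∧
(D4) ∧ CAP+tail; G-an2-4 gates asym, D1 and NE2/3/4.  This file changes none of it.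
-/

open Finset
open Literature.MathematicalPhysics.QuantumFieldTheory.Balaban1983to89

namespace Summit.QuantumFields.BalabanUV.T4Continuum.HistoryGenealogyExtraction

open HistoryAdmissible HistoryAdmissible.PGen T4PersistenceDictionary

/-! ## §1 Ancestors -/

namespace ComponentHistory

variable {γ : Type*} [DecidableEq γ] (H : ComponentHistory γ)

/-- **ANCESTORS**: `anc j c i` = the components of level `i` from which component `c` of level `j` descends (itself at
`i = j`; the union over its parts of their ancestors at `i < j`; empty above `j`). [folklore] -/
def anc : ℕ → γ → ℕ → Finset γ
  | 0, c, i => if i = 0 then {c} else ∅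
  | j + 1, c, i => if i = j + 1 then {c} else (H.parts (j + 1) c).toFinset.biUnion fun p => anc j p i

/-- a component is its own ancestor at its level [folklore] -/
@[simp] theorem anc_self (j : ℕ) (c : γ) : H.anc j c j = {c} := by
  cases j <;> simp [anc]

/-- no ancestors above the component's level [folklore] -/
theorem anc_eq_empty_of_lt {j i : ℕ} (h : j < i) (c : γ) : H.anc j c i = ∅ := by
  cases j with
  | zero => simp [anc, Nat.ne_of_gt h]
  | succ j =>
      have h1 : i ≠ j + 1 := Nat.ne_of_gt h
      have h2 : j < i := by omega
      simp only [anc, h1, if_false]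
      ext x
      simp [anc_eq_empty_of_lt h2]

/-- ancestors strictly below: the union over the parts [folklore] -/
theorem anc_succ_of_le {j i : ℕ} (h : i ≤ j) (c : γ) :
    H.anc (j + 1) c i = (H.parts (j + 1) c).toFinset.biUnion fun p => H.anc j p i := by
  have h1 : i ≠ j + 1 := by omega
  simp [anc, h1]

/-- membership below: through some part [folklore] -/
theorem mem_anc_succ_iff {j i : ℕ} (h : i ≤ j) (c a : γ) :
    a ∈ H.anc (j + 1) c i ↔ ∃ p ∈ H.parts (j + 1) c, a ∈ H.anc j p i := by
  simp [H.anc_succ_of_le h, List.mem_toFinset]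

/-- under `WF` ancestors are components of their level [folklore] -/
theorem anc_subset_comp (hW : H.WF) : ∀ (j : ℕ) (c : γ), c ∈ H.comp j → ∀ i, H.anc j c i ⊆ H.comp i
  | 0, c, hc, i => by
      by_cases hi : i = 0
      · subst hi; simpa [anc] using hc
      · simp [anc, hi]
  | j + 1, c, hc, i => by
      by_cases hi : i = j + 1
      · subst hi; simpa using hc
      · rcases Nat.lt_or_ge (j + 1) i with hlt | hle
        · simp [H.anc_eq_empty_of_lt hlt]
        · have hle' : i ≤ j := by omega
          intro a ha
          obtain ⟨p, hp, hap⟩ := (H.mem_anc_succ_iff hle' c a).1 ha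
          exact anc_subset_comp hW j p (hW.parts_sub j c hc p hp) i hap

/-- **DISTINCT COMPONENTS OF ONE LEVEL HAVE DISJOINT ANCESTOR SETS** (under `WF`) — the maximal structures partition
the (level, component) pairs they contain. [folklore] -/
theorem anc_disjoint (hW : H.WF) :
    ∀ (j : ℕ) (c c' : γ), c ∈ H.comp j → c' ∈ H.comp j → c ≠ c' → ∀ i, Disjoint (H.anc j c i) (H.anc j c' i)
  | 0, c, c', _, _, hne, i => by
      by_cases hi : i = 0
      · subst hi; simpa [anc] using hne
      · simp [anc, hi]
  | j + 1, c, c', hc, hc', hne, i => by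
      by_cases hi : i = j + 1
      · subst hi; simpa using hne
      · rcases Nat.lt_or_ge (j + 1) i with hlt | hle
        · simp [H.anc_eq_empty_of_lt hlt]
        · have hle' : i ≤ j := by omega
          rw [Finset.disjoint_left]
          intro a ha ha'
          obtain ⟨p, hp, hap⟩ := (H.mem_anc_succ_iff hle' c a).1 ha
          obtain ⟨p', hp', hap'⟩ := (H.mem_anc_succ_iff hle' c' a).1 ha'
          by_cases hpp : p = p'
          · subst hpp
            exact hne (H.parent_unique hW hc hc' hp hp')
          · exact Finset.disjoint_left.1
              (anc_disjoint hW j p p' (hW.parts_sub j c hc p hp) (hW.parts_sub j c' hc' p' hp') hpp i) hap hap'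

/-- distinct PARTS of one component have disjoint ancestor sets (under `WF`) [folklore] -/
theorem anc_disjoint_parts (hW : H.WF) {j : ℕ} {c p p' : γ} (hc : c ∈ H.comp (j + 1)) (hp : p ∈ H.parts (j + 1) c)
    (hp' : p' ∈ H.parts (j + 1) c) (hne : p ≠ p') (i : ℕ) : Disjoint (H.anc j p i) (H.anc j p' i) :=
  H.anc_disjoint hW j p p' (hW.parts_sub j c hc p hp) (hW.parts_sub j c hc p' hp') hne i

end ComponentHistory

/-! ## §2 The order-free birth key along the extraction -/

section PBirths

variable {γ : Type*}

/-- the birth key of a join chain is the sum over the constituents [folklore] -/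
theorem pbirths_joinTail (s : ℕ) : ∀ (T : PGen γ) (L : List (PGen γ)),
    (joinTail T L s).pbirths = T.pbirths + (L.map PGen.pbirths).sum
  | T, [] => by simp
  | T, U :: L => by simp [pbirths_joinTail s U L]

/-- the birth key of an assembled genealogy with a nonempty constituent list is the sum over the constituents (a
renewal adds nothing) [folklore] -/
theorem pbirths_assemble (c : γ) (s h : ℕ) :
    ∀ (L : List (PGen γ)) (r : Bool), L ≠ [] → (assemble c s h L r).pbirths = (L.map PGen.pbirths).sum
  | [], _, hL => (hL rfl).elim
  | [T], r, _ => by cases r <;> simp [assemble]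
  | T :: U :: L, _, _ => by simp [assemble, pbirths_joinTail]

/-- the ROOT of a genealogy — (root step, root cell) — is one of its booked births [folklore] -/
theorem root_mem_pbirths : ∀ P : PGen γ, ∃ d : ℕ, (((P.rootStep, 0, d) : PEv), P.rootCell) ∈ P.pbirths
  | PGen.birth j d z => ⟨d, by simp [rootStep, rootCell]⟩
  | PGen.renew G h => by simpa [rootStep, rootCell] using root_mem_pbirths G
  | PGen.join X Y s => by
      by_cases hXY : X.rootStep ≤ Y.rootStep
      · obtain ⟨d, hd⟩ := root_mem_pbirths X
        exact ⟨d, by simp [rootStep, rootCell, hXY, hd]⟩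
      · obtain ⟨d, hd⟩ := root_mem_pbirths Y
        have hYX : Y.rootStep ≤ X.rootStep := by omega
        exact ⟨d, by simp [rootStep, rootCell, hXY, min_eq_right hYX, hd]⟩

end PBirths

namespace ComponentHistory

variable {γ : Type*} [DecidableEq γ] (H : ComponentHistory γ)

/-- The birth-key entry of a new region `n` of step `s`: flat label `(s, 0, cls n)`, payload `n`. [folklore] -/
def btag (s : ℕ) (n : γ) : PEv × γ := (((s, 0, H.cls n) : PEv), n)

omit [DecidableEq γ] in
/-- the births of a component map to the tagged entries [folklore] -/
theorem map_pbirths_births (s : ℕ) (c : γ) :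
    ((H.news s c).map fun n => (PGen.birth s (H.cls n) n).pbirths).sum = ↑((H.news s c).map (H.btag s)) := by
  generalize H.news s c = L
  induction L with
  | nil => rfl
  | cons n L ih =>
      rw [List.map_cons, List.sum_cons, ih, pbirths_birth, Multiset.singleton_add, Multiset.cons_coe]
      rfl

/-- **ONE-STEP EQUATION OF THE BIRTH KEY** (under `WF`, `c ∈ comp (j+1)`): the key of the genealogy of `c` is the sum of
its parts' keys plus one tagged entry per new region inside. [folklore] -/
theorem pbirths_pgen_succ (hW : H.WF) (j : ℕ) (c : γ) (hc : c ∈ H.comp (j + 1)) :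
    (H.pgen (j + 1) c).pbirths =
      ((H.parts (j + 1) c).map fun p => (H.pgen j p).pbirths).sum + ↑((H.news (j + 1) c).map (H.btag (j + 1))) := by
  rw [pgen_succ_eq_assemble, pbirths_assemble c (j + 1) j _ _ (H.constituents_ne_nil hW _ hc), H.sum_map_constituents,
    map_pbirths_births]

/-- the birth key at level `0` (under `WF`, `c ∈ comp 0`): one tagged entry per new region [folklore] -/
theorem pbirths_pgen_zero (hW : H.WF) (c : γ) (hc : c ∈ H.comp 0) :
    (H.pgen 0 c).pbirths = ↑((H.news 0 c).map (H.btag 0)) := by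
  rw [pgen_zero_eq_assemble, pbirths_assemble c 0 0 _ _ (H.births_zero_ne_nil hW hc), births, List.map_map]
  exact H.map_pbirths_births 0 c

/-! ## §3 The closed form of the birth key, disjointness and duplicate-freeness -/

/-- **THE CLOSED FORM** (under `WF`, `c ∈ comp j`): an entry `(e, n)` is booked in the key of `pgen j c` iff it is the
tag of a new region `n ∈ news i a` of an ancestor `a ∈ anc j c i` at some level `i ≤ j`. [folklore] -/
theorem mem_pbirths_pgen_iff (hW : H.WF) :
    ∀ (j : ℕ) (c : γ), c ∈ H.comp j → ∀ x : PEv × γ,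
      x ∈ (H.pgen j c).pbirths ↔ ∃ i ≤ j, ∃ a ∈ H.anc j c i, x.2 ∈ H.news i a ∧ x = H.btag i x.2
  | 0, c, hc, x => by
      rw [H.pbirths_pgen_zero hW c hc, Multiset.mem_coe, List.mem_map]
      constructor
      · rintro ⟨n, hn, rfl⟩
        exact ⟨0, le_rfl, c, by simp, hn, rfl⟩
      · rintro ⟨i, hi, a, ha, hn, hx⟩
        obtain rfl : i = 0 := Nat.le_zero.1 hi
        simp only [anc_self, Finset.mem_singleton] at ha
        subst ha
        exact ⟨x.2, hn, hx.symm⟩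
  | j + 1, c, hc, x => by
      rw [H.pbirths_pgen_succ hW j c hc, Multiset.mem_add, Multiset.mem_coe, List.mem_map]
      have hsum : x ∈ ((H.parts (j + 1) c).map fun p => (H.pgen j p).pbirths).sum ↔
          ∃ p ∈ H.parts (j + 1) c, x ∈ (H.pgen j p).pbirths := by
        generalize H.parts (j + 1) c = L
        induction L with
        | nil => simp
        | cons q L ih => simp [ih]
      rw [hsum]
      constructor
      · rintro (⟨p, hp, hx⟩ | ⟨n, hn, rfl⟩)
        · obtain ⟨i, hi, a, ha, hn, hx'⟩ :=
            (mem_pbirths_pgen_iff hW j p (hW.parts_sub j c hc p hp) x).1 hx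
          exact ⟨i, by omega, a, (H.mem_anc_succ_iff hi c a).2 ⟨p, hp, ha⟩, hn, hx'⟩
        · exact ⟨j + 1, le_rfl, c, by simp, hn, rfl⟩
      · rintro ⟨i, hi, a, ha, hn, hx⟩
        by_cases hij : i = j + 1
        · subst hij
          simp only [anc_self, Finset.mem_singleton] at ha
          subst ha
          exact Or.inr ⟨x.2, hn, hx.symm⟩
        · have hi' : i ≤ j := by omega
          obtain ⟨p, hp, hap⟩ := (H.mem_anc_succ_iff hi' c a).1 ha
          exact Or.inl ⟨p, hp, (mem_pbirths_pgen_iff hW j p (hW.parts_sub j c hc p hp) x).2 ⟨i, hi', a, hap, hn, hx⟩⟩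

/-- every booked birth of `pgen j c` happened at a step `≤ j` (under `WF`) [folklore] -/
theorem step_le_of_mem_pbirths_pgen (hW : H.WF) {j : ℕ} {c : γ} (hc : c ∈ H.comp j) {x : PEv × γ}
    (hx : x ∈ (H.pgen j c).pbirths) : x.1.1 ≤ j := by
  obtain ⟨i, hi, a, _, _, hx⟩ := (H.mem_pbirths_pgen_iff hW j c hc x).1 hx
  rw [hx]
  exact hi

/-- **DISTINCT COMPONENTS OF ONE LEVEL HAVE DISJOINT BIRTH KEYS** (under `WF`): no new region is booked in two live
structures — the order-free key separates the maximal structures. [folklore] -/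
theorem pbirths_pgen_disjoint (hW : H.WF) {j : ℕ} {c c' : γ} (hc : c ∈ H.comp j) (hc' : c' ∈ H.comp j)
    (hne : c ≠ c') : Disjoint (H.pgen j c).pbirths (H.pgen j c').pbirths := by
  rw [Multiset.disjoint_iff_ne]
  rintro x hx _ hx' rfl
  obtain ⟨i, hi, a, ha, hn, hxe⟩ := (H.mem_pbirths_pgen_iff hW j c hc x).1 hx
  obtain ⟨i', _, a', ha', hn', hxe'⟩ := (H.mem_pbirths_pgen_iff hW j c' hc' x).1 hx'
  have hii : i = i' := by
    have h1 := congrArg (fun y : PEv × γ => y.1.1) (hxe.symm.trans hxe')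
    simpa [btag] using h1
  subst hii
  by_cases haa : a = a'
  · subst haa
    exact Finset.disjoint_left.1 (H.anc_disjoint hW j c c' hc hc' hne i) ha ha'
  · have hda := hW.news_disj i a a' (H.anc_subset_comp hW j c hc i ha) (H.anc_subset_comp hW j c' hc' i ha') haa
    exact Finset.disjoint_left.1 hda (List.mem_toFinset.2 hn) (List.mem_toFinset.2 hn')

/-- a list-indexed sum of duplicate-free, pairwise disjoint multisets over a duplicate-free index list is
duplicate-free [folklore] -/
theorem nodup_sum_map {ι α : Type*} (f : ι → Multiset α) :
    ∀ L : List ι, L.Nodup → (∀ i ∈ L, (f i).Nodup) → (∀ i ∈ L, ∀ i' ∈ L, i ≠ i' → Disjoint (f i) (f i')) →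
      (L.map f).sum.Nodup
  | [], _, _, _ => by simp
  | a :: L, hN, hf, hd => by
      rw [List.nodup_cons] at hN
      rw [List.map_cons, List.sum_cons, Multiset.nodup_add]
      refine ⟨hf a (by simp), nodup_sum_map f L hN.2 (fun i hi => hf i (by simp [hi]))
        (fun i hi i' hi' h => hd i (by simp [hi]) i' (by simp [hi']) h), ?_⟩
      clear hf
      induction L with
      | nil => simpa using (Multiset.zero_disjoint (f a)).symm
      | cons b L ih =>
          rw [List.map_cons, List.sum_cons, Multiset.disjoint_add_right]
          have hab : a ≠ b := fun h => hN.1 (by simp [h])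
          refine ⟨hd a (by simp) b (by simp) hab, ih ⟨fun h => hN.1 (by simp [h]), (List.nodup_cons.1 hN.2).2⟩ ?_⟩
          intro i hi i' hi' h
          exact hd i (by rcases List.mem_cons.1 hi with h | h <;> simp [h])
            i' (by rcases List.mem_cons.1 hi' with h | h <;> simp [h]) h

/-- the tagged entries of one level's new regions are duplicate-free (under `WF`) [folklore] -/
theorem nodup_map_btag (hW : H.WF) (s : ℕ) (c : γ) : ((H.news s c).map (H.btag s)).Nodup :=
  (hW.news_nodup s c).map fun n n' h => by simpa [btag] using congrArg Prod.snd h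

/-- **THE BIRTH KEY IS DUPLICATE-FREE** (under `WF`). [folklore] -/
theorem pbirths_pgen_nodup (hW : H.WF) : ∀ (j : ℕ) (c : γ), c ∈ H.comp j → (H.pgen j c).pbirths.Nodup
  | 0, c, hc => by
      rw [H.pbirths_pgen_zero hW c hc, Multiset.coe_nodup]
      exact H.nodup_map_btag hW 0 c
  | j + 1, c, hc => by
      rw [H.pbirths_pgen_succ hW j c hc, Multiset.nodup_add]
      refine ⟨?_, Multiset.coe_nodup.2 (H.nodup_map_btag hW (j + 1) c), ?_⟩
      · exact nodup_sum_map (fun p => (H.pgen j p).pbirths) _ (hW.parts_nodup _ _)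
          (fun p hp => pbirths_pgen_nodup hW j p (hW.parts_sub j c hc p hp))
          (fun p hp p' hp' hne => H.pbirths_pgen_disjoint hW (hW.parts_sub j c hc p hp) (hW.parts_sub j c hc p' hp') hne)
      · rw [Multiset.disjoint_iff_ne]
        rintro x hx _ hx' rfl
        -- `x` is booked in some part's key, hence at a step `≤ j`; the new entries sit at step `j + 1`
        have hsum : ∃ p ∈ H.parts (j + 1) c, x ∈ (H.pgen j p).pbirths := by
          revert hx
          generalize H.parts (j + 1) c = L
          induction L with
          | nil => simp
          | cons q L ih =>
              intro hx
              rw [List.map_cons, List.sum_cons, Multiset.mem_add] at hx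
              rcases hx with hx | hx
              · exact ⟨q, by simp, hx⟩
              · obtain ⟨p, hp, hxp⟩ := ih hx
                exact ⟨p, by simp [hp], hxp⟩
        obtain ⟨p, hp, hxp⟩ := hsum
        have hle := H.step_le_of_mem_pbirths_pgen hW (hW.parts_sub j c hc p hp) hxp
        rw [Multiset.mem_coe, List.mem_map] at hx'
        obtain ⟨n, -, hxn⟩ := hx'
        have : x.1.1 = j + 1 := by rw [← hxn]; rfl
        omega

/-- **THE ROOT SEPARATES THE LIVE STRUCTURES** (under `WF`): distinct components of one level have distinct (root step,
root cell) — the slot datum of the count (`BSlot`: root step, root cell, shape) is injective on the maximal structures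
before the shape is even read. [folklore] -/
theorem root_injective (hW : H.WF) {j : ℕ} {c c' : γ} (hc : c ∈ H.comp j) (hc' : c' ∈ H.comp j)
    (hs : (H.pgen j c).rootStep = (H.pgen j c').rootStep) (hz : (H.pgen j c).rootCell = (H.pgen j c').rootCell) :
    c = c' := by
  by_contra hne
  obtain ⟨d, hd⟩ := root_mem_pbirths (H.pgen j c)
  obtain ⟨d', hd'⟩ := root_mem_pbirths (H.pgen j c')
  obtain ⟨i, -, a, -, -, hx⟩ := (H.mem_pbirths_pgen_iff hW j c hc _).1 hd
  obtain ⟨i', -, a', -, -, hx'⟩ := (H.mem_pbirths_pgen_iff hW j c' hc' _).1 hd'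
  have hdd : d = H.cls (H.pgen j c).rootCell := by simpa [btag] using congrArg (fun y : PEv × γ => y.1.2.2) hx
  have hdd' : d' = H.cls (H.pgen j c').rootCell := by simpa [btag] using congrArg (fun y : PEv × γ => y.1.2.2) hx'
  have heq : ((((H.pgen j c).rootStep, 0, d) : PEv), (H.pgen j c).rootCell) =
      ((((H.pgen j c').rootStep, 0, d') : PEv), (H.pgen j c').rootCell) := by
    rw [hdd, hdd', hs, hz]
  exact Multiset.disjoint_iff_ne.1 (H.pbirths_pgen_disjoint hW hc hc' hne) _ hd _ hd' heq

end ComponentHistory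

/-! ## §4 Sanity, decided: the toy of part 2 -/

namespace Sanity

/-- the toy's final component descends from both level-0 components and both level-1 components [folklore] -/
example : toy.anc 2 5 0 = {1, 2} ∧ toy.anc 2 5 1 = {1, 2} ∧ toy.anc 2 5 2 = {5} := by decide

/-- its order-free birth key: the three tagged regions, duplicate-free [folklore] -/
example : (toy.pgen 2 5).pbirths = {(((0, 0, 1) : PEv), 1), (((0, 0, 2) : PEv), 2), (((2, 0, 0) : PEv), 7)} ∧
    (toy.pgen 2 5).pbirths.Nodup := by decide

/-- its root is the first-born constituent region `1` at step `0` [folklore] -/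
example : (toy.pgen 2 5).rootStep = 0 ∧ (toy.pgen 2 5).rootCell = 1 := by decide

end Sanity

end Summit.QuantumFields.BalabanUV.T4Continuum.HistoryGenealogyExtraction
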